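import Literature.NumberTheory.LFunctions.SoundararajanTypicalBridge
import HarnessLib

/-!
# Balazard–de Roton 2008, Prop. 18 with the 2008 threshold, for every `0 < δ ≤ 1`

Topic `Literature/NumberTheory/LFunctions`. Everything here is PROVED. `VTypicalOrdinates.lean`
(`isVTypical_of_RH`) proves M. Balazard–A. de Roton 2010, Prop. 9, whose threshold
`½ + (½+δ) L₃/L₂` (Goldston–Gonek parameter `ε = δ/2`) is below the 2008 threshold `½ + L₃/L₂` of
arXiv:0810.3587, Prop. 18 only for `δ ≤ ½`; decoupling `ε` from `δ` (`ε = ¼`) gives the 2008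
statement for every `0 < δ ≤ 1` (`isVTypical_of_RH_2008`), hence `TypicalLadder.Prop18With δ T₀`
for all such `δ` (`prop18With_of_RH'`), the shape consumed by the Soundararajan-contour files.

## References

* [BalazardDeRoton2008] M. Balazard, A. de Roton, arXiv:0810.3587, Prop. 18. [cite: BalazardDeRoton2008, Prop. 18]
* [BalazardDeRoton2010] M. Balazard, A. de Roton, arXiv:0812.1689, Prop. 9.
-/

noncomputable section

open Complex Filter Set Topology Finset ArithmeticFunction
open scoped Real

namespace Literature.NumberTheory.LFunctions

open Soundararajan TypicalLadder

open VTypical in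
/-- **Balazard–de Roton 2008, Prop. 18 (the 2008 threshold, every `0 < δ ≤ 1`), under RH**: there is
`T₀ = T₀(δ)` such that for `T ≥ T₀`, `(1/2 + log log log T/log log T) · log T/log log T ≤ V ≤ log T/log log T`
and `T ≤ t ≤ 2T`, the ordinate `t` is `V`-typical of size `T` (with parameter `δ`). Same proof as
`isVTypical_of_RH` (BdR 2010 Prop. 9) with the Goldston–Gonek parameter `ε = 1/4` decoupled from `δ`.
[cite: BalazardDeRoton2008, Prop. 18] -/
theorem isVTypical_of_RH_2008 (hRH : RiemannHypothesis) {δ : ℝ} (hδ0 : 0 < δ) (hδ1 : δ ≤ 1) :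
    ∃ T₀ : ℝ, ∀ T : ℝ, T₀ ≤ T → ∀ V : ℝ,
      (1 / 2 + (Real.log (Real.log (Real.log T)) / Real.log (Real.log T))) *
          (Real.log T / Real.log (Real.log T)) ≤ V →
      V ≤ Real.log T / Real.log (Real.log T) → ∀ t : ℝ, T ≤ t → t ≤ 2 * T → IsVTypical δ T V t := by
  obtain ⟨T₁, hT₁⟩ := zetaZeroCount_short_interval_GG_uniform_of_RH hRH (by norm_num : (0 : ℝ) < 1 / 4)
  obtain ⟨a₀, ha₀⟩ := Filter.eventually_atTop.1 (eventually_conditions_typical (1 / 2))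
  refine ⟨max T₁ (Real.exp a₀), fun T hT V hVl hVu t htl htu ↦ ?_⟩
  have hTT₁ : T₁ ≤ T := (le_max_left _ _).trans hT
  have hTa₀ : Real.exp a₀ ≤ T := (le_max_right _ _).trans hT
  have hT0 : 0 < T := (Real.exp_pos a₀).trans_le hTa₀
  -- notation `a = log T`, `b = log log T`, `c = log log log T`
  set a : ℝ := Real.log T with ha
  have haa₀ : a₀ ≤ a := by rw [ha, ← Real.log_exp a₀]; exact Real.log_le_log (Real.exp_pos _) hTa₀
  obtain ⟨ha4, hb2π, hbc, hb2640, hE5, hcδ⟩ := ha₀ a haa₀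
  set b : ℝ := Real.log a with hb
  set c : ℝ := Real.log b with hc
  have hπ3 := Real.pi_gt_three
  have hb0 : 0 < b := by linarith
  have hc4 : 4 ≤ c := by norm_num at hcδ; linarith
  have hc0 : 0 < c := by linarith
  have ha0 : 0 < a := by linarith
  have hTa : Real.exp a = T := by rw [ha, Real.exp_log hT0]
  have haT : a + 1 ≤ T := by rw [← hTa]; exact Real.add_one_le_exp a
  have hcb : c / b ≤ 1 / 2 := by
    rw [div_le_iff₀ hb0]; linarith only [hbc]
  have hcb0 : 0 ≤ c / b := by positivity
  -- size of `V`: `a/(2b) ≤ V ≤ a/b`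
  have hQ : (1 / 2 + (c / b)) * (a / b) = a / (2 * b) + (a * c / b ^ 2) := by
    field_simp
  have hVl' : a / (2 * b) + (a * c / b ^ 2) ≤ V := by rw [← hQ]; exact hVl
  have hacb : 0 ≤ a * c / b ^ 2 := by positivity
  have hVmin : a / (2 * b) ≤ V := by
    linarith only [hVl', hacb]
  have hV0 : 0 < V := lt_of_lt_of_le (by positivity) hVmin
  have hVa : V ≤ a / b := hVu
  have hVa' : V * b ≤ a := by rwa [le_div_iff₀ hb0] at hVa
  -- (i): `x = T^{1/V}` satisfies `log x = a/V ∈ [b, 2b]`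
  have hx_def : Real.log (T ^ (1 / V)) = a / V := by
    rw [Real.log_rpow hT0, ha]; ring
  have hlogx_ge : b ≤ a / V := by
    rw [le_div_iff₀ hV0]; linarith only [hVa', mul_comm V b]
  have hlogx_le : a / V ≤ 2 * b := by
    rw [div_le_iff₀ hV0]
    have := hVmin
    rw [div_le_iff₀ (by positivity)] at this
    linarith only [this]
  have hx2 : (2 : ℝ) ≤ T ^ (1 / V) := by
    have h1 : Real.log 2 ≤ Real.log (T ^ (1 / V)) := by
      rw [hx_def]
      have : Real.log 2 < 1 := by
        have := Real.log_two_lt_d9; linarith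
      linarith
    exact (Real.log_le_log_iff (by norm_num) (Real.rpow_pos_of_pos hT0 _)).1 h1
  have hprime : ∀ σ : ℝ, 1 / 2 ≤ σ → ‖typicalPrimeSum T V σ t‖ ≤ 2 * V := by
    intro σ hσ
    refine (norm_typicalPrimeSum_le (t := t) hx2 hσ).trans ?_
    rw [hx_def]
    set y : ℝ := a / V with hy
    have hy0 : 0 < y := by positivity
    -- `√x = exp(y/2) ≤ exp(b) = a`, so `1320 √x / y² ≤ 1320 a / b²`
    have hsqrt : Real.sqrt (T ^ (1 / V)) ≤ a := by
      have h1 : Real.sqrt (T ^ (1 / V)) = Real.exp (y / 2) := by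
        rw [Real.sqrt_eq_rpow, ← Real.exp_log (Real.rpow_pos_of_pos hT0 (1 / V)), ← Real.exp_mul, hx_def]
        ring_nf
      rw [h1, ← Real.exp_log ha0]
      exact Real.exp_le_exp.2 (by linarith)
    have hterm1 : 1320 * Real.sqrt (T ^ (1 / V)) / y ^ 2 ≤ 1320 * a / b ^ 2 := by
      have hyb : b ^ 2 ≤ y ^ 2 := by nlinarith only [hlogx_ge, hb0]
      calc 1320 * Real.sqrt (T ^ (1 / V)) / y ^ 2 ≤ 1320 * a / y ^ 2 := by gcongr
        _ ≤ 1320 * a / b ^ 2 := by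
            apply div_le_div_of_nonneg_left (by positivity) (by positivity) hyb
    have hterm2 : Real.log y ≤ c + 1 := by
      have h1 : Real.log y ≤ Real.log (2 * b) := Real.log_le_log hy0 hlogx_le
      have h2 : Real.log (2 * b) = Real.log 2 + c := by rw [Real.log_mul (by norm_num) hb0.ne', hc]
      have h3 : Real.log 2 < 1 := by have := Real.log_two_lt_d9; linarith
      linarith only [h1, h2, h3]
    -- now `1320 a/b² + (7/2)(c + 5) ≤ a/b ≤ 2V`
    have hgoal : 1320 * a / b ^ 2 + (7 / 2) * (c + 1 + 4) ≤ a / b := by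
      have h1 : 1320 * a / b ^ 2 ≤ a / (2 * b) := by
        rw [div_le_div_iff₀ (by positivity) (by positivity)]
        have hab : 0 ≤ a * b := by positivity
        have := mul_le_mul_of_nonneg_left hb2640 hab
        nlinarith only [this, hab]
      have h2 : (7 / 2) * (c + 1 + 4) ≤ a / (2 * b) := by
        rw [le_div_iff₀ (by positivity)]
        linarith only [hE5]
      have h3 : a / (2 * b) + a / (2 * b) = a / b := by field_simp; ring
      linarith only [h1, h2, h3]
    have h2V : a / b ≤ 2 * V := by
      have := hVmin
      rw [div_le_iff₀ (by positivity)] at this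
      rw [div_le_iff₀ hb0]; linarith only [this]
    linarith only [hterm1, hterm2, hgoal, h2V]
  -- (ii) and (iii) from Prop. 16 (uniform form, `ε = 1/4`)
  have hGG : ∀ t' h : ℝ, T - 1 ≤ t' → t' ≤ 2 * T + 1 → 0 < h → h ≤ 1 →
      ((zetaZeroCount (t' + h) : ℝ) - zetaZeroCount (t' - h)) ≤
        h / π * a + (a / (2 * b) + (1 / 2 + 1 / 4) * a * c / b ^ 2) := by
    intro t' h ht'l ht'u hh0 hh1
    have h1 := hT₁ T hTT₁ t' ht'l ht'u h hh0 hh1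
    have ht'0 : 0 < t' := by linarith only [ht'l, haT, ha4]
    have hlog : Real.log (t' / (2 * π)) ≤ a := by
      rw [ha]
      refine Real.log_le_log (by positivity) ?_
      rw [div_le_iff₀ (by positivity)]
      have : 2 * T + 1 ≤ T * (2 * π) := by nlinarith only [hπ3, haT, ha4]
      linarith only [this, ht'u]
    have h2 : h / π * Real.log (t' / (2 * π)) ≤ h / π * a := mul_le_mul_of_nonneg_left hlog (by positivity)
    linarith only [h1, h2]
  have h58 : (1 / 2 + 1 / 4) * a * c / b ^ 2 = (1 / 2 + 1 / 4) * (a * c / b ^ 2) := by ring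
  refine ⟨htl, htu, hprime, fun u hul huu ↦ ?_, fun u hul huu ↦ ?_⟩
  · -- (ii): window of length `2πδV/log T`, `h = πδV/a ≤ πδ/b ≤ 1`
    set h : ℝ := π * δ * V / a with hh
    have hh0 : 0 < h := by positivity
    have hh1 : h ≤ 1 := by
      rw [hh, div_le_one ha0]
      calc π * δ * V ≤ π * 1 * (a / b) := by gcongr
        _ ≤ a := by
            rw [mul_one, mul_div_assoc', div_le_iff₀ hb0]; nlinarith only [hb2π, ha0, hπ3]
    have hlen : 2 * π * δ * V / Real.log T = 2 * h := by rw [hh, ← ha]; ring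
    rw [hlen] at huu ⊢
    have := hGG (u + h) h (by linarith) (by linarith) hh0 hh1
    rw [show u + h + h = u + 2 * h by ring, show u + h - h = u by ring] at this
    have hδV : h / π * a = δ * V := by rw [hh]; field_simp
    rw [hδV, h58] at this
    have hmono : (1 / 2 + 1 / 4) * (a * c / b ^ 2) ≤ (a * c / b ^ 2) := by
      nlinarith only [hacb]
    linarith only [this, hVl', hmono, hδ0, hV0]
  · -- (iii): window of length `2πV/((log V) log T)`, `h = πV/((log V) a) ≤ 1`
    have hlogV : b / 2 ≤ Real.log V := by
      have h1 : Real.log (a / (2 * b)) ≤ Real.log V := Real.log_le_log (by positivity) hVmin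
      have h2 : Real.log (a / (2 * b)) = b - Real.log (2 * b) := by
        rw [Real.log_div ha0.ne' (by positivity)]
      have h3 : Real.log (2 * b) = Real.log 2 + c := by rw [Real.log_mul (by norm_num) hb0.ne']
      have h4 : Real.log 2 < 1 := by have := Real.log_two_lt_d9; linarith
      linarith only [h1, h2, h3, h4, hbc]
    have hlogV0 : 0 < Real.log V := by linarith only [hlogV, hb0]
    set h : ℝ := π * V / (Real.log V * a) with hh
    have hh0 : 0 < h := by positivity
    have hVlogV : V / Real.log V ≤ 2 * a / b ^ 2 := by
      rw [div_le_div_iff₀ hlogV0 (by positivity)]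
      calc V * b ^ 2 = (V * b) * b := by ring
        _ ≤ a * b := by gcongr
        _ = 2 * a * (b / 2) := by ring
        _ ≤ 2 * a * Real.log V := by gcongr
    have hh1 : h ≤ 1 := by
      rw [hh, div_le_one (by positivity)]
      have : π * V / Real.log V ≤ a := by
        calc π * V / Real.log V = π * (V / Real.log V) := by ring
          _ ≤ π * (2 * a / b ^ 2) := by gcongr
          _ ≤ a := by
              rw [mul_div_assoc', div_le_iff₀ (by positivity)]
              have hπ4 : π < 4 := Real.pi_lt_four
              have hb2 : 8 ≤ b ^ 2 := by nlinarith only [hb2π, hπ3]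
              nlinarith only [hb2, ha0, hπ4]
      rw [div_le_iff₀ hlogV0] at this
      exact this.trans_eq (mul_comm _ _)
    have hlen : 2 * π * V / (Real.log V * Real.log T) = 2 * h := by rw [hh, ← ha]; ring
    rw [hlen] at huu ⊢
    have := hGG (u + h) h (by linarith) (by linarith) hh0 hh1
    rw [show u + h + h = u + 2 * h by ring, show u + h - h = u by ring] at this
    have hhV : h / π * a = V / Real.log V := by rw [hh]; field_simp
    rw [hhV] at this
    have hsmall : V / Real.log V ≤ (1 / 4) * (a * c / b ^ 2) := by
      refine hVlogV.trans ?_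
      rw [show (1 / 4 : ℝ) * (a * c / b ^ 2) = (1 / 4 * a * c) / b ^ 2 by ring,
        div_le_div_iff_of_pos_right (by positivity)]
      -- `2a ≤ (1/4) a c` since `c ≥ 8`
      have hc8 : (8 : ℝ) ≤ c := by norm_num at hcδ; linarith
      nlinarith only [hc8, ha0]
    rw [h58] at this
    have hsplit : (1 / 2 + 1 / 4) * (a * c / b ^ 2) + (1 / 4) * (a * c / b ^ 2) = (a * c / b ^ 2) := by
      ring
    linarith only [this, hsmall, hVl', hsplit]


/-- **Balazard–de Roton 2008, Prop. 18 (in the consumed shape), under RH, for every `0 < δ ≤ 1`.**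
[cite: BalazardDeRoton2008, Prop. 18] -/
theorem prop18With_of_RH' (hRH : RiemannHypothesis) {δ : ℝ} (hδ0 : 0 < δ) (hδ1 : δ ≤ 1) :
    ∃ T₀ : ℝ, Prop18With δ T₀ := by
  obtain ⟨T₀, hT₀⟩ := isVTypical_of_RH_2008 hRH hδ0 hδ1
  refine ⟨max T₀ (Real.exp (Real.exp (Real.exp 1))), fun T hT V hVl hVu t ht1 ht2 ↦ ?_⟩
  have hTT₀ : T₀ ≤ T := (le_max_left _ _).trans hT
  have hTe : Real.exp (Real.exp (Real.exp 1)) ≤ T := (le_max_right _ _).trans hT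
  have hT0 : 0 < T := (Real.exp_pos _).trans_le hTe
  have hL1 : Real.exp (Real.exp 1) ≤ Real.log T := by
    rw [← Real.log_exp (Real.exp (Real.exp 1))]; exact Real.log_le_log (Real.exp_pos _) hTe
  have hL1pos : 0 < Real.log T := (Real.exp_pos _).trans_le hL1
  have hL2 : Real.exp 1 ≤ Real.log (Real.log T) := by
    rw [← Real.log_exp (Real.exp 1)]; exact Real.log_le_log (Real.exp_pos _) hL1
  have hL2pos : 0 < Real.log (Real.log T) := (Real.exp_pos _).trans_le hL2
  refine isTypical_of_isVTypical (hT₀ T hTT₀ V ?_ ?_ t ht1 ht2)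
  · calc (1 / 2 + (Real.log (Real.log (Real.log T)) / Real.log (Real.log T))) *
          (Real.log T / Real.log (Real.log T))
        ≤ V * Real.log (Real.log T) / Real.log T * (Real.log T / Real.log (Real.log T)) :=
          mul_le_mul_of_nonneg_right hVl (by positivity)
      _ = V := by field_simp
  · rw [le_div_iff₀ hL2pos]
    have := (div_le_one hL1pos).1 hVu
    linarith

end Literature.NumberTheory.LFunctions
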